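import Literature.AnabelianGeometry.EtaleTheta.Discharge.Sec5OfQuotientTemperoidRootDataKummer

/-!
# [EtTh] §5 data over `B^temp(G)⁰` — print's Prop. 5.2 (i) FIRST FORM (order `l·N` at the `A_⊙`-anchor) and the re-anchored second form

S. Mochizuki, *The étale theta function and its Frobenioid-theoretic manifestations*, Publ. RIMS **45** (2009) [MochizukiEtTh2009],
Prop. 5.2 (i) p.324 (PDF p.98): "`(s_{l·N}, τ_{l·N})` constitutes an `l·N`-th root of a right fraction-pair of `Θ̈`, or, alternatively, an `N`-th
root of a right fraction-pair of an `l`-th root of `Θ̈` [cf. Remark 4.3.2]"; (iii) first clause (`μ_{l·N}(−) ≅ Δ_Θ ⊗ ℤ/l·N`); §5 pp.330–331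
(PDF pp.104–105); Rmk. 4.3.2 p.318 (PDF p.92) [cite: MochizukiEtTh2009, Prop 5.2 (i) p.324 (PDF p.98)].

abc-iut cell, layer L2 [EtTh]; seat abc-iut-L2-t3 (gen 10), row «JUNCTION TWIN» — abc-iut-L2-lead R1385 (FINDING F-L2t3g10-3 adopted: form =
FIRST FORM at Kummer order `l·N`, §2 datum `T : ThetaEnvData (l·N)`).  Thin instances of the common core `ofQuotientTemperoidRootData`:
* **`ThetaFrobenioid.ofQuotientTemperoidDataFirstForm h Q odd_l Rt ιX K' constEmb constEmb_injective hinvc hinvp`** — the §5 data from ONE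
  root `Rt : S.NthRoot θ Pl (l·N)` of `Θ̈ = θ`'s right fraction-pair `Pl` on `A_⊙` IN THE `A_⊙`-ANCHORED SETTING `S` (the type abc-iut-L2-t3's
  `nonempty_nthRoot_settingSmallYdd … (l·N) θ Pl` INHABITS at the carrier of record, p512762), §2 datum at order `l·N`; `A_⊚ := A_⊙`, `Θ := θ`,
  prime `l := lv`.  TYPE = the frozen constructor's.  ALL of abc-iut-L2-t4's §5 named inputs but Lemma 5.8's arithmetic step are THEOREMS:
  `strvSection_`, `sgpCapSpec_`, `sgpCupSpec_`, `sgpCapSection_`, `autAmpleBN_`, and **`biKummerDifferenceMem_ofQuotientTemperoidDataFirstForm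
  (hH : Π^tp_Ÿ ⊆ H_⊙)`** (Prop. 4.3 (iii) in `μ_{l·N}(B_{l·N})` — INHERITED from the nested proof through `Sec5OfQuotientTemperoidRootDataKummer`,
  the dictionary laws discharged at the identity dictionary by abc-iut-L2-t9's `coe_fracOfModel_mul_unit` / `coe_biratAutModel_eq_pull`);
  **`facts_ofQuotientTemperoidDataFirstForm (hH) (hK)`** — `Facts ⟸ {Π^tp_Ÿ ⊆ H_⊙, ConstantsActByCyclotome}`.
* `BiKummerSetting.FractionPair.reanchorQuotientTemperoid` and **`ThetaFrobenioid.ofQuotientTemperoidDataReanchored … Rl hA hA' Rt …`** — the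
  SECOND (re-anchored, Rmk. 4.3.2) form at DATUM level: inputs `(Rl : S.NthRoot θ Pl l)`, `(Rt : S′.NthRoot Rl.root Pl′ N)` with
  `S′ := mkOfQuotientTemperoid … Rl.AN hA hA'`; same TYPE; five unconditional laws; `Facts ⟸ {BiKummerDifferenceMem, hK}` displayed — its
  Prop. 4.3 (iii) would need the `Ÿ̲̲`-level clause `Π^tp_Ÿ ⊆ Ker(Π^tp_X → Aut(A_l^bs))` (R1385: booked VNEXT, unkeyed).
HONEST FRAMING: constructors and kernel-checked consequences for data so constructed over abc-iut-L2-t3's quotient-temperoid setting; an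
instance at OUR carriers is not print's universal statement; [EtTh]/[FrdI] are refereed prerequisite papers; nothing here bears on, or takes
a side on, the disputed [IUTchIII] Cor. 3.12; nothing here asserts abc proved or refuted.
-/

noncomputable section

namespace Literature.AnabelianGeometry.EtaleTheta

open CategoryTheory Opposite Literature.AlgebraicGeometry.Frobenioids Literature.AnabelianGeometry.SemiGraphs
  Literature.AnabelianGeometry.SemiGraphs.GaloisObjects

universe u₀ v₀ u w

variable {K : Type u₀} [Field K] {X : SemiGraphs.TemperedArithmeticGroup.{u₀} K}
  {G : Type u} [Group G] [TopologicalSpace G] [IsTopologicalGroup G] {hG : IsTempered G}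
  {φ : X.Pi →ₜ* G} {hφ : Function.Surjective φ}
  {D₀ : Type u₀} [Category.{v₀} D₀] {V : FrdIMonoidStub.{w}} {T₀ : RealifiedDivisorMonoids (D₀ := D₀) V}
  {VD : FrdICatStub.{u + 1, u, w} (ConnectedPart (BTemp G))}
  {tf : TemperedFrobenioid T₀ (ConnectedPart (BTemp G)) VD} {hZ : tf.monoidType = MonoidType.Z}
  {hP : ∀ A : (ConnectedPart (BTemp G))ᵒᵖ, IsPerfect (tf.Φ.carrier A)}
  {NH : Subgroup (Field.absoluteGaloisGroup K) → tf.category → ℕ+ → Prop} {A₀ : tf.category}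
  {hA₀ : PreFrobenioid.IsFrobeniusTrivial tf.toElem A₀} {hA₀' : SemiGraphs.IsGaloisObj A₀.base.obj}

namespace ThetaFrobenioid

section FirstForm

variable
  {pullFrac : ∀ {A A' : (BiKummerSetting.mkOfQuotientTemperoid X hG φ hφ tf hZ hP NH A₀ hA₀ hA₀').C} (_ : A' ⟶ A),
    (BiKummerSetting.mkOfQuotientTemperoid X hG φ hφ tf hZ hP NH A₀ hA₀ hA₀').biratUnits A →
      (BiKummerSetting.mkOfQuotientTemperoid X hG φ hφ tf hZ hP NH A₀ hA₀ hA₀').biratUnits A'}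
  {lv N : ℕ+} {T : ThetaEnvData.{max u w} (lv * N)}
  {θ : (BiKummerSetting.mkOfQuotientTemperoid X hG φ hφ tf hZ hP NH A₀ hA₀ hA₀').biratUnits
    (BiKummerSetting.mkOfQuotientTemperoid X hG φ hφ tf hZ hP NH A₀ hA₀ hA₀').Aodot}
  {Bl : (BiKummerSetting.mkOfQuotientTemperoid X hG φ hφ tf hZ hP NH A₀ hA₀ hA₀').C}
  {Pl : (BiKummerSetting.mkOfQuotientTemperoid X hG φ hφ tf hZ hP NH A₀ hA₀ hA₀').FractionPair θ Bl}
  (h : ModelFrobenioid.Hypotheses tf.divisorMonoid tf.ratFnFunctor)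
  (Q : FrobenioidTheta.ThetaSubquotientStub.{w} (ConnectedPart (BTemp G))) (odd_l : Odd (lv : ℕ))
  (Rt : (BiKummerSetting.mkOfQuotientTemperoid X hG φ hφ tf hZ hP NH A₀ hA₀ hA₀').NthRoot θ Pl (lv * N) pullFrac)
  (ιX : T.PiX ≃ₜ* X.Pi) (K' : Type w) [Field K'] (constEmb : K'ˣ →* tf.biratUnitsModel Rt.BN)
  (constEmb_injective : Function.Injective constEmb)
  (hinvc : ∀ g : Aut Rt.AN.base,
    pull tf.divisorMonoid g.hom (ModelFrobenioid.div Rt.pair.num) = ModelFrobenioid.div Rt.pair.num)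
  (hinvp : ∀ y : T.PiX, y ∈ T.PiYdd →
    pull tf.divisorMonoid ((BiKummerSetting.mkOfQuotientTemperoid X hG φ hφ tf hZ hP NH A₀ hA₀ hA₀').galoisSurj Rt.AN.base
      Rt.αData.isGalois (ιX y)).hom (ModelFrobenioid.div Rt.pair.den) = ModelFrobenioid.div Rt.pair.den)

/-- **Print's Prop. 5.2 (i) FIRST FORM** (p.324 (PDF p.98): "an `l·N`-th root of a right fraction-pair of `Θ̈`"): the [EtTh] §5 data over
`B^temp(G)⁰` from ONE root `Rt` of order `l·N` of the right fraction-pair `Pl` of `Θ̈ = θ` on `A_⊙`, taken in the `A_⊙`-anchored setting, with the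
§2 datum `T` at order `l·N` — the common core at `(f, P, M) := (θ, Pl, l·N)`.  `A_⊚ := A_⊙`, `Θ := θ`, `l := lv`,
`(A_{l·N}, B_{l·N}, s^⊓, s^⊔, ρ, s^trv) :=` those of `Rt`.  [cite: MochizukiEtTh2009, Prop 5.2 (i) p.324 (PDF p.98); §5 p.330–331 (PDF pp.104–105)] -/
def ofQuotientTemperoidDataFirstForm :
    ThetaFrobenioid.{w} (BiKummerSetting.mkOfQuotientTemperoid X hG φ hφ tf hZ hP NH A₀ hA₀ hA₀').C (ConnectedPart (BTemp G)) :=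
  ofQuotientTemperoidRootData θ h Q odd_l Rt ιX K' constEmb constEmb_injective hinvc hinvp

/-- The first form IS the common core at `(θ, Pl, l·N)` (definitionally). [cite: MochizukiEtTh2009, Prop 5.2 (i) p.324 (PDF p.98)] -/
theorem ofQuotientTemperoidDataFirstForm_eq :
    ofQuotientTemperoidDataFirstForm h Q odd_l Rt ιX K' constEmb constEmb_injective hinvc hinvp =
      ofQuotientTemperoidRootData θ h Q odd_l Rt ιX K' constEmb constEmb_injective hinvc hinvp := rfl

/-- The operations are the model's `(Base, Div, deg_Fr)` ([FrdI] Thm. 5.2 (i)). [cite: MochizukiFrdI2008, Thm. 5.2 (i) p.100] -/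
theorem ofQuotientTemperoidDataFirstForm_pre :
    (ofQuotientTemperoidDataFirstForm h Q odd_l Rt ιX K' constEmb constEmb_injective hinvc hinvp).pre =
      PreFrobenioidData.ofModel tf.divisorMonoid tf.ratFnFunctor tf.divBNatTrans := rfl

/-- `A_⊚ = A_⊙`, `Θ = θ`, `l = lv`. [cite: MochizukiEtTh2009, §5 p.330 (PDF p.104)] -/
theorem ofQuotientTemperoidDataFirstForm_Acirc_thetaFn_l :
    (ofQuotientTemperoidDataFirstForm h Q odd_l Rt ιX K' constEmb constEmb_injective hinvc hinvp).Acirc =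
        (BiKummerSetting.mkOfQuotientTemperoid X hG φ hφ tf hZ hP NH A₀ hA₀ hA₀').Aodot ∧
      (ofQuotientTemperoidDataFirstForm h Q odd_l Rt ιX K' constEmb constEmb_injective hinvc hinvp).thetaFn = θ ∧
      (ofQuotientTemperoidDataFirstForm h Q odd_l Rt ιX K' constEmb constEmb_injective hinvc hinvp).l = lv := ⟨rfl, rfl, rfl⟩

/-- `(A_{l·N}, B_{l·N}) = (Rt.AN, Rt.BN)`, `s^trv = strvOfRoot h Rt`, `Π^tp_X = T.PiX`. [cite: MochizukiEtTh2009, §5 p.330–331 (PDF pp.104–105)] -/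
theorem ofQuotientTemperoidDataFirstForm_AN_BN_strv_PiX :
    (ofQuotientTemperoidDataFirstForm h Q odd_l Rt ιX K' constEmb constEmb_injective hinvc hinvp).AN = Rt.AN ∧
      (ofQuotientTemperoidDataFirstForm h Q odd_l Rt ιX K' constEmb constEmb_injective hinvc hinvp).BN = Rt.BN ∧
      (ofQuotientTemperoidDataFirstForm h Q odd_l Rt ιX K' constEmb constEmb_injective hinvc hinvp).strv = strvOfRoot h Rt ∧
      (ofQuotientTemperoidDataFirstForm h Q odd_l Rt ιX K' constEmb constEmb_injective hinvc hinvp).PiX = T.PiX := ⟨rfl, rfl, rfl, rfl⟩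

/-- **`StrvSection` — UNCONDITIONAL.** [cite: MochizukiEtTh2009, §5 p.331 (PDF p.105)] -/
theorem strvSection_ofQuotientTemperoidDataFirstForm : (ofQuotientTemperoidDataFirstForm h Q odd_l Rt ιX K' constEmb constEmb_injective hinvc hinvp).StrvSection :=
  strvSection_ofQuotientTemperoidRootData θ h Q odd_l Rt ιX K' constEmb constEmb_injective hinvc hinvp

/-- `SgpCapSpec`. [cite: MochizukiEtTh2009, §5 p.331 (PDF p.105)] -/
theorem sgpCapSpec_ofQuotientTemperoidDataFirstForm : (ofQuotientTemperoidDataFirstForm h Q odd_l Rt ιX K' constEmb constEmb_injective hinvc hinvp).SgpCapSpec :=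
  sgpCapSpec_ofQuotientTemperoidRootData θ h Q odd_l Rt ιX K' constEmb constEmb_injective hinvc hinvp

/-- `SgpCupSpec`. [cite: MochizukiEtTh2009, §5 p.331 (PDF p.105)] -/
theorem sgpCupSpec_ofQuotientTemperoidDataFirstForm : (ofQuotientTemperoidDataFirstForm h Q odd_l Rt ιX K' constEmb constEmb_injective hinvc hinvp).SgpCupSpec :=
  sgpCupSpec_ofQuotientTemperoidRootData θ h Q odd_l Rt ιX K' constEmb constEmb_injective hinvc hinvp

/-- `SgpCapSection`. [cite: MochizukiEtTh2009, §5 p.331 (PDF p.105)] -/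
theorem sgpCapSection_ofQuotientTemperoidDataFirstForm : (ofQuotientTemperoidDataFirstForm h Q odd_l Rt ιX K' constEmb constEmb_injective hinvc hinvp).SgpCapSection :=
  sgpCapSection_ofQuotientTemperoidRootData θ h Q odd_l Rt ιX K' constEmb constEmb_injective hinvc hinvp

/-- `AutAmpleBN` ("`B_N` is Aut-ample", p.330 (PDF p.104)). [cite: MochizukiEtTh2009, §5 p.330 (PDF p.104)] -/
theorem autAmpleBN_ofQuotientTemperoidDataFirstForm : (ofQuotientTemperoidDataFirstForm h Q odd_l Rt ιX K' constEmb constEmb_injective hinvc hinvp).AutAmpleBN :=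
  autAmpleBN_ofQuotientTemperoidRootData θ h Q odd_l Rt ιX K' constEmb constEmb_injective hinvc hinvp

/-- **Prop. 4.3 (iii) for the first form — DISCHARGED from `Π^tp_Ÿ ⊆ H_⊙` alone**: the bi-Kummer difference lies in `μ_{l·N}(B_{l·N})`
(the nested proof of abc-iut-L2-t4, inherited through the common core; the `fixed` clause is `Rt`'s own in the `A_⊙`-anchored setting; the
dictionary laws hold at the identity dictionary by `coe_fracOfModel_mul_unit` / `coe_biratAutModel_eq_pull`).
[cite: MochizukiEtTh2009, Prop 4.3 (iii) p.317 (PDF p.91); Prop 5.2 (iii) p.324 (PDF p.98)] -/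
theorem biKummerDifferenceMem_ofQuotientTemperoidDataFirstForm
    (hH : ∀ y : T.PiX, y ∈ T.PiYdd → ιX y ∈ (BiKummerSetting.mkOfQuotientTemperoid X hG φ hφ tf hZ hP NH A₀ hA₀ hA₀').Hodot) :
    (ofQuotientTemperoidDataFirstForm h Q odd_l Rt ιX K' constEmb constEmb_injective hinvc hinvp).BiKummerDifferenceMem :=
  biKummerDifferenceMem_ofQuotientTemperoidRootData θ h Q odd_l Rt ιX K' constEmb constEmb_injective hinvc hinvp hH
    (fun _ => MonoidHom.id _) (fun s' s'' _ _ _ => BiKummerSetting.coe_fracOfModel_mul_unit tf T₀.isUnit_BΛ s' s'')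
    (fun e x => BiKummerSetting.coe_biratAutModel_eq_pull tf e x)

/-- **`Facts` for the first form ⟸ {`Π^tp_Ÿ ⊆ H_⊙`, `ConstantsActByCyclotome` (Lemma 5.8)}** — every other §5 named input a THEOREM.
[cite: MochizukiEtTh2009, §5 p.330–331 (PDF pp.104–105)] -/
theorem facts_ofQuotientTemperoidDataFirstForm
    (hH : ∀ y : T.PiX, y ∈ T.PiYdd → ιX y ∈ (BiKummerSetting.mkOfQuotientTemperoid X hG φ hφ tf hZ hP NH A₀ hA₀ hA₀').Hodot)
    (hK : (ofQuotientTemperoidDataFirstForm h Q odd_l Rt ιX K' constEmb constEmb_injective hinvc hinvp).ConstantsActByCyclotome) :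
    (ofQuotientTemperoidDataFirstForm h Q odd_l Rt ιX K' constEmb constEmb_injective hinvc hinvp).Facts :=
  facts_ofQuotientTemperoidRootData θ h Q odd_l Rt ιX K' constEmb constEmb_injective hinvc hinvp
    (biKummerDifferenceMem_ofQuotientTemperoidDataFirstForm h Q odd_l Rt ιX K' constEmb constEmb_injective hinvc hinvp hH) hK

end FirstForm

end ThetaFrobenioid

namespace BiKummerSetting

/-- **A fraction pair of the `A_⊙`-anchored quotient-temperoid setting read in the setting re-anchored at `A₁`** (Rmk. 4.3.2, p.318 (PDF
p.92): the `N`-th root of an `l`-th root is taken over the `l`-domain): both settings have the SAME tempered Frobenioid, pre-steps,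
base-equivalence, fractions and divisors (only `A_⊙`, `H_⊙` change), so the pair is carried over field by field (definitionally).
[cite: MochizukiEtTh2009, Rmk 4.3.2 p.318 (PDF p.92)] -/
def FractionPair.reanchorQuotientTemperoid {A B : (mkOfQuotientTemperoid X hG φ hφ tf hZ hP NH A₀ hA₀ hA₀').C}
    {f : (mkOfQuotientTemperoid X hG φ hφ tf hZ hP NH A₀ hA₀ hA₀').biratUnits A}
    (P : (mkOfQuotientTemperoid X hG φ hφ tf hZ hP NH A₀ hA₀ hA₀').FractionPair f B) (A₁ : tf.category)
    (hA₁ : PreFrobenioid.IsFrobeniusTrivial tf.toElem A₁) (hA₁' : SemiGraphs.IsGaloisObj A₁.base.obj) :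
    (mkOfQuotientTemperoid X hG φ hφ tf hZ hP NH A₁ hA₁ hA₁').FractionPair (A := A) f B where
  num := P.num
  den := P.den
  isPreStep_num := P.isPreStep_num
  isPreStep_den := P.isPreStep_den
  base_eq := P.base_eq
  frac_eq := P.frac_eq
  disjointSupports := P.disjointSupports

/-- The re-anchored pair has the same pre-steps. [cite: MochizukiEtTh2009, Rmk 4.3.2 p.318 (PDF p.92)] -/
theorem FractionPair.reanchorQuotientTemperoid_num_den {A B : (mkOfQuotientTemperoid X hG φ hφ tf hZ hP NH A₀ hA₀ hA₀').C}
    {f : (mkOfQuotientTemperoid X hG φ hφ tf hZ hP NH A₀ hA₀ hA₀').biratUnits A}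
    (P : (mkOfQuotientTemperoid X hG φ hφ tf hZ hP NH A₀ hA₀ hA₀').FractionPair f B) (A₁ : tf.category)
    (hA₁ : PreFrobenioid.IsFrobeniusTrivial tf.toElem A₁) (hA₁' : SemiGraphs.IsGaloisObj A₁.base.obj) :
    (P.reanchorQuotientTemperoid A₁ hA₁ hA₁').num = P.num ∧ (P.reanchorQuotientTemperoid A₁ hA₁ hA₁').den = P.den := ⟨rfl, rfl⟩

end BiKummerSetting

namespace ThetaFrobenioid

section Reanchored

variable
  {pullFrac : ∀ {A A' : (BiKummerSetting.mkOfQuotientTemperoid X hG φ hφ tf hZ hP NH A₀ hA₀ hA₀').C} (_ : A' ⟶ A),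
    (BiKummerSetting.mkOfQuotientTemperoid X hG φ hφ tf hZ hP NH A₀ hA₀ hA₀').biratUnits A →
      (BiKummerSetting.mkOfQuotientTemperoid X hG φ hφ tf hZ hP NH A₀ hA₀ hA₀').biratUnits A'}
  {lv N : ℕ+} {T : ThetaEnvData.{max u w} N}
  {θ : (BiKummerSetting.mkOfQuotientTemperoid X hG φ hφ tf hZ hP NH A₀ hA₀ hA₀').biratUnits
    (BiKummerSetting.mkOfQuotientTemperoid X hG φ hφ tf hZ hP NH A₀ hA₀ hA₀').Aodot}
  {Bl : (BiKummerSetting.mkOfQuotientTemperoid X hG φ hφ tf hZ hP NH A₀ hA₀ hA₀').C}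
  {Pl : (BiKummerSetting.mkOfQuotientTemperoid X hG φ hφ tf hZ hP NH A₀ hA₀ hA₀').FractionPair θ Bl}
  (h : ModelFrobenioid.Hypotheses tf.divisorMonoid tf.ratFnFunctor)
  (Q : FrobenioidTheta.ThetaSubquotientStub.{w} (ConnectedPart (BTemp G))) (odd_l : Odd (lv : ℕ))
  (Rl : (BiKummerSetting.mkOfQuotientTemperoid X hG φ hφ tf hZ hP NH A₀ hA₀ hA₀').NthRoot θ Pl lv pullFrac)
  (hA : PreFrobenioid.IsFrobeniusTrivial tf.toElem Rl.AN) (hA' : SemiGraphs.IsGaloisObj Rl.AN.base.obj)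
  {Bl' : (BiKummerSetting.mkOfQuotientTemperoid X hG φ hφ tf hZ hP NH Rl.AN hA hA').C}
  {Pl' : (BiKummerSetting.mkOfQuotientTemperoid X hG φ hφ tf hZ hP NH Rl.AN hA hA').FractionPair Rl.root Bl'}
  (Rt : (BiKummerSetting.mkOfQuotientTemperoid X hG φ hφ tf hZ hP NH Rl.AN hA hA').NthRoot Rl.root Pl' N pullFrac)
  (ιX : T.PiX ≃ₜ* X.Pi) (K' : Type w) [Field K'] (constEmb : K'ˣ →* tf.biratUnitsModel Rt.BN)
  (constEmb_injective : Function.Injective constEmb)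
  (hinvc : ∀ g : Aut Rt.AN.base,
    pull tf.divisorMonoid g.hom (ModelFrobenioid.div Rt.pair.num) = ModelFrobenioid.div Rt.pair.num)
  (hinvp : ∀ y : T.PiX, y ∈ T.PiYdd →
    pull tf.divisorMonoid ((BiKummerSetting.mkOfQuotientTemperoid X hG φ hφ tf hZ hP NH Rl.AN hA hA').galoisSurj Rt.AN.base
      Rt.αData.isGalois (ιX y)).hom (ModelFrobenioid.div Rt.pair.den) = ModelFrobenioid.div Rt.pair.den)

/-- **The re-anchored «JUNCTION TWIN» of the frozen §5 constructor** (§5 p.330 (PDF p.104); Rmk. 4.3.2): the [EtTh] §5 data over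
`B^temp(G)⁰` with `A_⊚ := A_⊙`, `Θ := θ` (an `l`-th root `Rl` of which is given in the `A_⊙`-anchored setting), and `(A_N, B_N, s^⊓_N,
s^⊔_N, ρ, s^trv_N) :=` those of an `N`-th root `Rt` of a fraction pair `Pl′` of `Rl.root = Θ^{1/l}` taken in the setting RE-ANCHORED at the
`l`-domain `A_l = Rl.AN` — the common core `ofQuotientTemperoidRootData` at that setting.  Same TYPE as `ofQuotientTemperoidData`.
[cite: MochizukiEtTh2009, §5 p.330–331 (PDF pp.104–105); Rmk 4.3.2 p.318 (PDF p.92)] -/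
def ofQuotientTemperoidDataReanchored :
    ThetaFrobenioid.{w} (BiKummerSetting.mkOfQuotientTemperoid X hG φ hφ tf hZ hP NH A₀ hA₀ hA₀').C (ConnectedPart (BTemp G)) :=
  ofQuotientTemperoidRootData (A₀ := Rl.AN) (hA₀ := hA) (hA₀' := hA')
    (Acirc := (BiKummerSetting.mkOfQuotientTemperoid X hG φ hφ tf hZ hP NH A₀ hA₀ hA₀').Aodot) θ h Q odd_l Rt ιX K' constEmb
    constEmb_injective hinvc hinvp

/-- The twin unfolds to the common core at the re-anchored setting (definitionally). [cite: MochizukiEtTh2009, §5 p.330 (PDF p.104)] -/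
theorem ofQuotientTemperoidDataReanchored_eq :
    ofQuotientTemperoidDataReanchored h Q odd_l Rl hA hA' Rt ιX K' constEmb constEmb_injective hinvc hinvp =
      ofQuotientTemperoidRootData (A₀ := Rl.AN) (hA₀ := hA) (hA₀' := hA')
        (Acirc := (BiKummerSetting.mkOfQuotientTemperoid X hG φ hφ tf hZ hP NH A₀ hA₀ hA₀').Aodot) θ h Q odd_l Rt ιX K' constEmb
        constEmb_injective hinvc hinvp := rfl

/-- The operations are the model's `(Base, Div, deg_Fr)` ([FrdI] Thm. 5.2 (i)) — as for the frozen constructor (`h𝔉 := rfl` discharges apply).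
[cite: MochizukiFrdI2008, Thm. 5.2 (i) p.100] -/
theorem ofQuotientTemperoidDataReanchored_pre :
    (ofQuotientTemperoidDataReanchored h Q odd_l Rl hA hA' Rt ιX K' constEmb constEmb_injective hinvc hinvp).pre =
      PreFrobenioidData.ofModel tf.divisorMonoid tf.ratFnFunctor tf.divBNatTrans := rfl

/-- `A_⊚ = A_⊙` (the ORIGINAL anchor) and `Θ = θ`. [cite: MochizukiEtTh2009, §5 p.330 (PDF p.104)] -/
theorem ofQuotientTemperoidDataReanchored_Acirc_thetaFn :
    (ofQuotientTemperoidDataReanchored h Q odd_l Rl hA hA' Rt ιX K' constEmb constEmb_injective hinvc hinvp).Acirc =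
        (BiKummerSetting.mkOfQuotientTemperoid X hG φ hφ tf hZ hP NH A₀ hA₀ hA₀').Aodot ∧
      (ofQuotientTemperoidDataReanchored h Q odd_l Rl hA hA' Rt ιX K' constEmb constEmb_injective hinvc hinvp).thetaFn = θ :=
  ⟨rfl, rfl⟩

/-- `(A_N, B_N) = (Rt.AN, Rt.BN)`, `s^trv_N = strvOfRoot h Rt`, `Π^tp_X = T.PiX`. [cite: MochizukiEtTh2009, §5 p.330–331 (PDF pp.104–105)] -/
theorem ofQuotientTemperoidDataReanchored_AN_BN_strv_PiX :
    (ofQuotientTemperoidDataReanchored h Q odd_l Rl hA hA' Rt ιX K' constEmb constEmb_injective hinvc hinvp).AN = Rt.AN ∧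
      (ofQuotientTemperoidDataReanchored h Q odd_l Rl hA hA' Rt ιX K' constEmb constEmb_injective hinvc hinvp).BN = Rt.BN ∧
      (ofQuotientTemperoidDataReanchored h Q odd_l Rl hA hA' Rt ιX K' constEmb constEmb_injective hinvc hinvp).strv =
        strvOfRoot h Rt ∧
      (ofQuotientTemperoidDataReanchored h Q odd_l Rl hA hA' Rt ιX K' constEmb constEmb_injective hinvc hinvp).PiX = T.PiX :=
  ⟨rfl, rfl, rfl, rfl⟩

/-- **`StrvSection` — UNCONDITIONAL.** [cite: MochizukiEtTh2009, §5 p.331 (PDF p.105)] -/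
theorem strvSection_ofQuotientTemperoidDataReanchored :
    (ofQuotientTemperoidDataReanchored h Q odd_l Rl hA hA' Rt ιX K' constEmb constEmb_injective hinvc hinvp).StrvSection :=
  strvSection_ofQuotientTemperoidRootData (A₀ := Rl.AN) (hA₀ := hA) (hA₀' := hA')
    (Acirc := (BiKummerSetting.mkOfQuotientTemperoid X hG φ hφ tf hZ hP NH A₀ hA₀ hA₀').Aodot) θ h Q odd_l Rt ιX K' constEmb
    constEmb_injective hinvc hinvp

/-- `SgpCapSpec`. [cite: MochizukiEtTh2009, §5 p.331 (PDF p.105)] -/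
theorem sgpCapSpec_ofQuotientTemperoidDataReanchored :
    (ofQuotientTemperoidDataReanchored h Q odd_l Rl hA hA' Rt ιX K' constEmb constEmb_injective hinvc hinvp).SgpCapSpec :=
  sgpCapSpec_ofQuotientTemperoidRootData (A₀ := Rl.AN) (hA₀ := hA) (hA₀' := hA')
    (Acirc := (BiKummerSetting.mkOfQuotientTemperoid X hG φ hφ tf hZ hP NH A₀ hA₀ hA₀').Aodot) θ h Q odd_l Rt ιX K' constEmb
    constEmb_injective hinvc hinvp

/-- `SgpCupSpec`. [cite: MochizukiEtTh2009, §5 p.331 (PDF p.105)] -/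
theorem sgpCupSpec_ofQuotientTemperoidDataReanchored :
    (ofQuotientTemperoidDataReanchored h Q odd_l Rl hA hA' Rt ιX K' constEmb constEmb_injective hinvc hinvp).SgpCupSpec :=
  sgpCupSpec_ofQuotientTemperoidRootData (A₀ := Rl.AN) (hA₀ := hA) (hA₀' := hA')
    (Acirc := (BiKummerSetting.mkOfQuotientTemperoid X hG φ hφ tf hZ hP NH A₀ hA₀ hA₀').Aodot) θ h Q odd_l Rt ιX K' constEmb
    constEmb_injective hinvc hinvp

/-- `SgpCapSection`. [cite: MochizukiEtTh2009, §5 p.331 (PDF p.105)] -/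
theorem sgpCapSection_ofQuotientTemperoidDataReanchored :
    (ofQuotientTemperoidDataReanchored h Q odd_l Rl hA hA' Rt ιX K' constEmb constEmb_injective hinvc hinvp).SgpCapSection :=
  sgpCapSection_ofQuotientTemperoidRootData (A₀ := Rl.AN) (hA₀ := hA) (hA₀' := hA')
    (Acirc := (BiKummerSetting.mkOfQuotientTemperoid X hG φ hφ tf hZ hP NH A₀ hA₀ hA₀').Aodot) θ h Q odd_l Rt ιX K' constEmb
    constEmb_injective hinvc hinvp

/-- `AutAmpleBN` ("`B_N` is Aut-ample", p.330 (PDF p.104)). [cite: MochizukiEtTh2009, §5 p.330 (PDF p.104)] -/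
theorem autAmpleBN_ofQuotientTemperoidDataReanchored :
    (ofQuotientTemperoidDataReanchored h Q odd_l Rl hA hA' Rt ιX K' constEmb constEmb_injective hinvc hinvp).AutAmpleBN :=
  autAmpleBN_ofQuotientTemperoidRootData (A₀ := Rl.AN) (hA₀ := hA) (hA₀' := hA')
    (Acirc := (BiKummerSetting.mkOfQuotientTemperoid X hG φ hφ tf hZ hP NH A₀ hA₀ hA₀').Aodot) θ h Q odd_l Rt ιX K' constEmb
    constEmb_injective hinvc hinvp

/-- **`Facts` for the re-anchored twin from `BiKummerDifferenceMem` (Prop. 4.3 (iii)) and `ConstantsActByCyclotome` (Lemma 5.8) DISPLAYED**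
(F-L2t3g10-3: the tree's Prop. 4.3 (iii) proof would need `Π^tp_Ÿ ⊆ Ker(Π^tp_X → Aut(A_l^bs))` here).
[cite: MochizukiEtTh2009, §5 p.330–331 (PDF pp.104–105)] -/
theorem facts_ofQuotientTemperoidDataReanchored
    (hdiff : (ofQuotientTemperoidDataReanchored h Q odd_l Rl hA hA' Rt ιX K' constEmb constEmb_injective hinvc
      hinvp).BiKummerDifferenceMem)
    (hK : (ofQuotientTemperoidDataReanchored h Q odd_l Rl hA hA' Rt ιX K' constEmb constEmb_injective hinvc
      hinvp).ConstantsActByCyclotome) :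
    (ofQuotientTemperoidDataReanchored h Q odd_l Rl hA hA' Rt ιX K' constEmb constEmb_injective hinvc hinvp).Facts :=
  facts_ofQuotientTemperoidRootData (A₀ := Rl.AN) (hA₀ := hA) (hA₀' := hA')
    (Acirc := (BiKummerSetting.mkOfQuotientTemperoid X hG φ hφ tf hZ hP NH A₀ hA₀ hA₀').Aodot) θ h Q odd_l Rt ιX K' constEmb
    constEmb_injective hinvc hinvp hdiff hK

end Reanchored

end ThetaFrobenioid

end Literature.AnabelianGeometry.EtaleTheta

end
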